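import Literature.Computability.AlgebraicComplexity.PowerSumProductObstructionsProofs
import Literature.Computability.AlgebraicComplexity.BILPS19LatinRectangleConditionEventually
import HarnessLib

/-!
# Kumar's rectangles `m δ_i` in `ℂ[Chow_m]` WITHOUT the Alon–Tarsi hypothesis: under `LRC(i, m)`,
# hence for every even `m` and `i ≤ min(12, m)`, and for every even `m ≥ 2 i²`

Kumar 2015, Thm. 5.6 (as used by Ikenmeyer–Kandasamy 2020, Prop. 5.3, proof: "Kumar proved [Kum:15]
that `mult_{(m)^*} ℂ[\overline{G(x_1⋯x_m)}] ≥ 1` and that `mult_{(m × m)^*} ℂ[\overline{G(x_1⋯x_m)}] ≥ 1`,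
provided that `m` satisfies the Alon-Tarsi condition"): under `♯CELS(m) ≠ ♯COLS(m)` every rectangle
`i × m = m δ_i`, `i ≤ m`, occurs in the coordinate ring of the Chow variety
`Chow_m = \overline{GL_m · x_0⋯x_{m-1}}` — tree: `IK2020.hasHighestWeight_chowOrbitRep_rectWeight` /
`IK2020.rectW_mem_chowOccWeights` (file `PowerSumProductObstructionsProofs.lean`), whose ONLY use of the
Latin-square hypothesis is `designPoly i m ≠ 0`.

By the x5 files on BILPS 2019 Conj. 26 (`BILPS19LatinRectangleCondition{AlonTarsi,Additivity,
Eventually}.lean`), `designPoly i m ≠ 0 ⇔ LRC(i, m)` (`latinRectangleCondition_iff_designPoly_ne_zero`),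
and `LRC(i, m)` is a THEOREM of the tree for `i ≤ 12`, `m` even `≥ i`, and for all `i` once `m` is
even `≥ 2 i²`. This theorem-only file threads that through the Chow-variety argument:

* `hasHighestWeight_chowOrbitRep_rectWeight_of_latinRectangleCondition`,
  `rectW_mem_chowOccWeights_of_latinRectangleCondition` — `m δ_i ∈ S(Chow_m)` under `LRC(i, m)`
  (the tree's proof verbatim, the design-polynomial input supplied by `LRC`);
* `rectW_mem_chowOccWeights_of_le_twelve` — **for every even `m` and `i ≤ min(12, m)`,
  `m δ_i ∈ S(Chow_m)` unconditionally**; `rectW_mem_chowOccWeights_of_two_mul_sq_le` — the same for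
  every `i ≤ m` with `m` even, `m ≥ 2 i²`.

Honest framing (val-lit): occurrences in `ℂ[Chow_m]` (plethysm side); nothing here is an obstruction
and nothing bears on `VP ≠ VNP`. No definitions, no named facts.

## References
* [Kumar2015] S. Kumar, Compositio Math. 151 (2015), Thm. 5.6, Thm. 6.1 (proof).
* [IkenmeyerKandasamy2019] C. Ikenmeyer, U. Kandasamy, STOC 2020 = arXiv:1911.03990, Prop. 5.3 (proof).
* [BlaserIkenmeyerLysikovPandeySchreyer2019] arXiv:1911.02534, §7.3 (Conj. 26 = `LRC`).
-/

noncomputable section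

open MvPolynomial

namespace Literature.Computability.AlgebraicComplexity

open _root_.Literature.NumberTheory.DiophantineGeometry
open _root_.Literature.Barriers.ValiantsHypothesis
open _root_.Literature.Computability.Complexity
open Kumar2015 BILPS2019

namespace IK2020

variable {m i : ℕ}

/-- The enumeration of the top `i` indices of `Fin m` is strictly increasing. [folklore] -/
private theorem topIdx_strictMono (him : i ≤ m) :
    StrictMono fun a : Fin i => Fin.cast (Nat.sub_add_cancel him) (Fin.natAdd (m - i) a) := by
  intro a b hab
  rw [Fin.lt_def]
  simp only [Fin.val_cast, Fin.val_natAdd]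
  exact Nat.add_lt_add_left hab _

/-- The top `i` indices form an upper set. [folklore] -/
private theorem topIdx_upper (him : i ≤ m) (a : Fin i) (x : Fin m)
    (hx : Fin.cast (Nat.sub_add_cancel him) (Fin.natAdd (m - i) a) ≤ x) :
    ∃ b : Fin i, Fin.cast (Nat.sub_add_cancel him) (Fin.natAdd (m - i) b) = x := by
  rw [Fin.le_def] at hx
  simp only [Fin.val_cast, Fin.val_natAdd] at hx
  refine ⟨⟨(x : ℕ) - (m - i), by omega⟩, Fin.ext ?_⟩
  simp only [Fin.val_cast, Fin.val_natAdd]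
  omega

/-- An index is one of the top `i` indices iff it is at least `m - i`. [folklore] -/
private theorem mem_range_topIdx_iff (him : i ≤ m) (x : Fin m) :
    x ∈ Set.range (fun a : Fin i => Fin.cast (Nat.sub_add_cancel him) (Fin.natAdd (m - i) a)) ↔
      m - i ≤ (x : ℕ) := by
  constructor
  · rintro ⟨a, rfl⟩
    simp only [Fin.val_cast, Fin.val_natAdd]
    omega
  · intro hx
    refine ⟨⟨(x : ℕ) - (m - i), by omega⟩, Fin.ext ?_⟩
    simp only [Fin.val_cast, Fin.val_natAdd]
    omega

/-- `x_0 ⋯ x_{m-1} ≠ 0`. [folklore] -/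
private theorem chowMonomial_ne_zero' (m : ℕ) : chowMonomial ℂ m ≠ 0 := by
  rw [chowMonomial]
  exact Finset.prod_ne_zero_iff.mpr fun i _ => X_ne_zero i

/-- **Kumar's occurrences in `ℂ[Chow_m]` under `LRC(i, m)`**: if the Latin-rectangle condition
`LRC(i, m)` holds (`i ≤ m`), the dual rectangle weight `rectWeight m t` on the top `i` variables occurs
in the coordinate ring of `Chow_m = \overline{GL_m · x_0⋯x_{m-1}}`. Same proof as the tree's
`IK2020.hasHighestWeight_chowOrbitRep_rectWeight`, with `designPoly i m ≠ 0` supplied by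
`latinRectangleCondition_iff_designPoly_ne_zero`. [cite: Kumar2015, Thm. 5.6 and Thm. 6.1 (proof)] -/
theorem hasHighestWeight_chowOrbitRep_rectWeight_of_latinRectangleCondition (m i : ℕ) (him : i ≤ m)
    (hL : latinRectangleCondition i m) :
    HasHighestWeight (orbitCoordRep (chowMonomial ℂ m) m)
      (rectWeight m fun a : Fin i => Fin.cast (Nat.sub_add_cancel him) (Fin.natAdd (m - i) a)) := by
  classical
  have hF := hyperdetPoly_mem_highestWeightSpace (k := ℂ) (ℓ := m) (topIdx_strictMono him)
    (topIdx_upper him)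
  refine hasHighestWeight_orbitCoordRep_of_not_mem _ m hF ?_
  have hP : designPoly i m ≠ 0 := latinRectangleCondition_iff_designPoly_ne_zero.mp hL
  obtain ⟨c, hc⟩ : ∃ c : Fin m × Fin i → ℂ, aeval c (designPoly i m) ≠ 0 := by
    by_contra hcon
    push Not at hcon
    apply hP
    apply MvPolynomial.map_injective (Int.castRingHom ℂ) Int.cast_injective
    rw [map_zero]
    apply MvPolynomial.funext
    intro c
    rw [eval_map, map_zero]
    have := hcon c
    rwa [aeval_def, algebraMap_int_eq] at this
  have hval : aeval (formCoeff m (linProd c fun a : Fin i =>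
      Fin.cast (Nat.sub_add_cancel him) (Fin.natAdd (m - i) a)))
      (hyperdetPoly m (fun a : Fin i => Fin.cast (Nat.sub_add_cancel him) (Fin.natAdd (m - i) a)) :
        MvPolynomial (DegIdx (Fin m) m) ℂ) ≠ 0 := by
    rw [aeval_formCoeff_hyperdetPoly, hyperdet_arrOf_linProd c (topIdx_strictMono him).injective]
    exact mul_ne_zero (pow_ne_zero _ (inv_ne_zero (Nat.cast_ne_zero.mpr
      (Nat.factorial_ne_zero m)))) hc
  intro hI
  exact hval (aeval_formCoeff_eq_zero_of_mem_orbitClosure (chowMonomial_isHomogeneous ℂ m)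
    (chowMonomial_ne_zero' m) (linProd_mem_orbitClosure_chowMonomial c _) hI)

/-- The dual of the rectangle weight `m δ_i` is `-m` on the top `i` indices (`rectWeight m t`).
[folklore] -/
private theorem dual_rectW' (him : i ≤ m) :
    Weight.dual (fun r : Fin m => if (r : ℕ) < i then (m : ℤ) else 0) =
      rectWeight m fun a : Fin i => Fin.cast (Nat.sub_add_cancel him) (Fin.natAdd (m - i) a) := by
  funext x
  rw [Weight.dual, rectWeight]
  by_cases hx : m - i ≤ (x : ℕ)
  · rw [if_pos ((mem_range_topIdx_iff him x).mpr hx), if_pos]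
    rw [Fin.val_rev]; omega
  · rw [if_neg (fun h => hx ((mem_range_topIdx_iff him x).mp h)), if_neg, neg_zero]
    rw [Fin.val_rev]; omega

/-- **`m δ_i ∈ S(Chow_m)` under `LRC(i, m)`** (`i ≤ m`). [cite: Kumar2015, Thm. 5.6] -/
theorem rectW_mem_chowOccWeights_of_latinRectangleCondition (him : i ≤ m)
    (hL : latinRectangleCondition i m) :
    (fun r : Fin m => if (r : ℕ) < i then (m : ℤ) else 0) ∈ chowOccWeights m := by
  rw [mem_chowOccWeights_iff, dual_rectW' him]
  exact hasHighestWeight_chowOrbitRep_rectWeight_of_latinRectangleCondition m i him hL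

/-- **`m δ_i ∈ S(Chow_m)` unconditionally for every even `m` and `i ≤ min(12, m)`** (the rectangle
`i × m` occurs in `ℂ[Chow_m]`; `LRC(i, m)` by `latinRectangleCondition_of_le_twelve`).
[cite: Kumar2015, Thm. 5.6] [cite: IkenmeyerKandasamy2019, Prop. 5.3 (proof)] -/
theorem rectW_mem_chowOccWeights_of_le_twelve (hm : Even m) (h12 : i ≤ 12) (him : i ≤ m) :
    (fun r : Fin m => if (r : ℕ) < i then (m : ℤ) else 0) ∈ chowOccWeights m :=
  rectW_mem_chowOccWeights_of_latinRectangleCondition him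
    (latinRectangleCondition_of_le_twelve h12 him hm)

/-- `m δ_i ∈ S(Chow_m)` unconditionally for every `i ≤ m` with `m` even and `2 i² ≤ m`.
[cite: Kumar2015, Thm. 5.6] -/
theorem rectW_mem_chowOccWeights_of_two_mul_sq_le (hm : Even m) (him : i ≤ m)
    (hsq : 2 * i ^ 2 ≤ m) :
    (fun r : Fin m => if (r : ℕ) < i then (m : ℤ) else 0) ∈ chowOccWeights m :=
  rectW_mem_chowOccWeights_of_latinRectangleCondition him
    (latinRectangleCondition_of_two_mul_sq_le hsq hm)

end IK2020

end Literature.Computability.AlgebraicComplexity
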